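import Summits.CriticalPhenomena.PercolationContinuityZ3.Theorems.PercAnnulusCrossingIICClusterMarkov
import HarnessLib

/-!
# The IIC given the shape of the cluster of the origin in a box: inside Bernoulli-conditioned, outside rooted IIC, independently (lane RSW3, p1 gen 8)

builds on p205010 (kernel theorem, internal audit signed; external expert review pending) — NOT used in this file.

RSW3 lane (LANE 3 `prim-rsw3`), seat `prim-rsw3-p1` (gen 8).  Helper file (`--supports stmt-CriticalPhenomena-4575`); no definitions, no sorries;
every `d`, every `p`.  Notation of `…IICRootedEdgeObstacle` §4 / `…IICClusterMarkov`: `V ∋ 0`, `V ⊆ Λ(m)`, connected through the pair set `G`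
inside `V`; `F` = pairs from `V` to `Λ(m) ∖ V`; `CL = CL_m(V) = {F closed} ∩ {0 ↔ v in V ∀ v ∈ V}`; `C = {F closed, G open}`.  An INSIDE event
`E_in` is one determined by pairs of `F ∪ V.sym2`; an OUTSIDE event `E_out` one determined by finitely many pairs off `F ∪ V.sym2`.

* `real_insideClusterBox_inter_siteToBoundary_eq` — `P_p(E_in ∩ CL ∩ E_out ∩ A_n) = P_p(E_in ∩ CL) · P_p(E_out ∩ CONN_F(V;n))` (`n > m`);
* **`iicMeasure_real_inside_outside_clusterBox_mul_eq`** — `ν(E_in ∩ CL ∩ E_out) · P_p(C) = P_p(E_in ∩ CL) · ν(E_out ∩ C)`;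
* **`iicMeasure_real_inside_clusterBox_mul_eq`** — THE INSIDE LAW: `ν(E_in ∩ CL) · P_p(CL) = P_p(E_in ∩ CL) · ν(CL)`: given the shape `V` of the
  cluster of `0` in `Λ(m)`, the configuration on the pairs at `V` has under the IIC EXACTLY its critical-Bernoulli conditional law;
* **`iicMeasure_condIndep_inside_outside_clusterBox`** — CONDITIONAL INDEPENDENCE: `ν(E_in ∩ CL ∩ E_out) · ν(CL) = ν(E_in ∩ CL) · ν(E_out ∩ CL)`.
Together with `…IICRootedEdgeObstacle` (shape law = `P_p`-law tilted by the capacity) and `…IICClusterMarkov` (outside law = rooted IIC) this is a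
complete Gibbs-type description of Kesten's IIC seen through the cluster of the origin in a box.  Limit property only.
References: H. Kesten, PTRF 73 (1986) §2; D. Basu, A. Sapozhnikov, ECP 22 (2017) no. 26, Thm 1.1; G. Grimmett, *Percolation* (1999), §2.2.
-/

noncomputable section

namespace Summit.CriticalPhenomena.PercolationContinuityZ3.Theorems.Crossing

open MeasureTheory Filter Topology Literature.Probability.Percolation Literature.Probability.LatticeModels
open Literature.Probability.Percolation.DCT16

variable {d : ℕ}

/-- `P_p((E_in ∩ CL_m(V)) ∩ E_out ∩ A_n) = P_p(E_in ∩ CL_m(V)) · P_p(E_out ∩ CONN_F(V;n))` for `n > m`, `E_in` measurable determined by `F ∪ V.sym2`,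
`E_out` measurable determined by a set of pairs disjoint from `F ∪ V.sym2`. [cite: Kesten1986, §2 (2.16)] -/
theorem real_insideClusterBox_inter_siteToBoundary_eq (p : unitInterval) {m n : ℕ} (hmn : m < n) {V : Finset (Site d)} (hVm : V ⊆ box d m)
    (h0 : (0 : Site d) ∈ V) {F : Finset (Sym2 (Site d))} (hF : ∀ e, e ∈ F ↔ ∃ a ∈ V, ∃ b ∈ box d m, b ∉ V ∧ e = s(a, b))
    {Ein : Set (BondConfig (Site d))} (hEinm : MeasurableSet Ein) (hEin : DeterminedBy Ein (↑(F ∪ V.sym2) : Set (Sym2 (Site d))))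
    {Eout : Set (BondConfig (Site d))} (hEoutm : MeasurableSet Eout) {T : Set (Sym2 (Site d))} (hEout : DeterminedBy Eout T)
    (hT : Disjoint T ↑(F ∪ V.sym2)) :
    (bondPercolation (zdGraph d) p).real (Ein ∩ ({ω : BondConfig (Site d) | ∀ e ∈ F, e ∉ ω} ∩
        {ω | ∀ v ∈ V, ω ∈ openConnIn (↑V : Set (Site d)) 0 v}) ∩ Eout ∩ siteToBoundary d n) =
      (bondPercolation (zdGraph d) p).real (Ein ∩ ({ω : BondConfig (Site d) | ∀ e ∈ F, e ∉ ω} ∩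
          {ω | ∀ v ∈ V, ω ∈ openConnIn (↑V : Set (Site d)) 0 v})) *
        (bondPercolation (zdGraph d) p).real (Eout ∩ {ω : BondConfig (Site d) | ∃ x ∈ V, ∃ t ∈ innerBoundary (zdGraph d) (box d n),
          ω \ (↑F : Set (Sym2 (Site d))) ∈ openConnIn (↑(box d n) : Set (Site d)) x t}) := by
  classical
  set μ := bondPercolation (zdGraph d) p with hμ
  set CL := ({ω : BondConfig (Site d) | ∀ e ∈ F, e ∉ ω} ∩ {ω | ∀ v ∈ V, ω ∈ openConnIn (↑V : Set (Site d)) 0 v}) with hCLdef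
  have hVsym : ∀ e ∈ V.sym2, ∀ v ∈ e, v ∈ V := fun e he v hv => by rw [Finset.mem_sym2_iff] at he; exact he v hv
  have hset : Ein ∩ CL ∩ Eout ∩ siteToBoundary d n = (Ein ∩ CL) ∩ (Eout ∩ {ω : BondConfig (Site d) | ∃ x ∈ V,
      ∃ t ∈ innerBoundary (zdGraph d) (box d n), ω \ (↑(F ∪ V.sym2) : Set (Sym2 (Site d))) ∈ openConnIn (↑(box d n) : Set (Site d)) x t}) := by
    have h := clusterBox_inter_siteToBoundary_eq hmn hVm h0 hF
    ext ω
    simp only [Set.mem_inter_iff]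
    constructor
    · rintro ⟨⟨⟨hin, hcl⟩, hout⟩, hA⟩
      have h' : ω ∈ CL ∩ siteToBoundary d n := ⟨hcl, hA⟩
      rw [h] at h'
      exact ⟨⟨hin, hcl⟩, hout, h'.2⟩
    · rintro ⟨⟨hin, hcl⟩, hout, hconn⟩
      have h' : ω ∈ CL ∩ {ω : BondConfig (Site d) | ∃ x ∈ V, ∃ t ∈ innerBoundary (zdGraph d) (box d n),
          ω \ (↑(F ∪ V.sym2) : Set (Sym2 (Site d))) ∈ openConnIn (↑(box d n) : Set (Site d)) x t} := ⟨hcl, hconn⟩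
      rw [← h] at h'
      exact ⟨⟨⟨hin, hcl⟩, hout⟩, h'.2⟩
  have hCLdet : DeterminedBy CL (↑(F ∪ V.sym2) : Set (Sym2 (Site d))) := by
    rw [Finset.coe_union]
    refine (determinedBy_forall_notMem F).mono Set.subset_union_left |>.inter ?_
    have h : {ω : BondConfig (Site d) | ∀ v ∈ V, ω ∈ openConnIn (↑V : Set (Site d)) 0 v} = ⋂ v ∈ V, openConnIn (↑V : Set (Site d)) 0 v := by
      ext ω; simp only [Set.mem_setOf_eq, Set.mem_iInter]
    rw [h, determinedBy_iff]
    intro ω ω' hωω'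
    simp only [Set.mem_iInter]
    refine forall₂_congr fun v _ => ?_
    have hdet := determinedBy_openConnIn (↑V : Set (Site d)) (0 : Site d) v (K := (↑F : Set (Sym2 (Site d))) ∪ ↑V.sym2)
      (by rw [Finset.coe_sym2]; exact Set.subset_union_right)
    exact (determinedBy_iff _ _).1 hdet ω ω' hωω'
  have hEoutdet : DeterminedBy (Eout ∩ {ω : BondConfig (Site d) | ∃ x ∈ V, ∃ t ∈ innerBoundary (zdGraph d) (box d n),
      ω \ (↑(F ∪ V.sym2) : Set (Sym2 (Site d))) ∈ openConnIn (↑(box d n) : Set (Site d)) x t}) (↑(F ∪ V.sym2) : Set (Sym2 (Site d)))ᶜ :=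
    (hEout.mono (Set.subset_compl_iff_disjoint_right.2 hT)).inter (determinedBy_connOff V (F ∪ V.sym2) n)
  rw [hset, bondPercolation_real_inter_of_disjoint (zdGraph d) p disjoint_compl_right (hEin.inter hCLdet) hEoutdet
    (hEinm.inter hCLdet.measurableSet_of_finset) (hEoutm.inter (measurableSet_connOff V (F ∪ V.sym2) n)),
    connOff_union_eq_connOff (F := F) hVsym n]

/-- **`ν(E_in ∩ CL_m(V) ∩ E_out) · P_p(C) = P_p(E_in ∩ CL_m(V)) · ν(E_out ∩ C)`** for every measure `ν` with Kesten's IIC limit property, every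
inside cylinder `E_in` (determined by `F ∪ V.sym2`) and outside cylinder `E_out` (determined by finitely many pairs off `F ∪ V.sym2`).
[cite: Kesten1986, Thm. (3) and §2 (2.16)] [cite: BasuSapozhnikov2017ECP, Thm. 1.1] -/
theorem iicMeasure_real_inside_outside_clusterBox_mul_eq (p : unitInterval) {ν : Measure (BondConfig (Site d))}
    (hν : ∀ (F : Finset (Sym2 (Site d))) (E : Set (BondConfig (Site d))), MeasurableSet E → DeterminedBy E ↑F →
      Tendsto (fun n : ℕ => (bondPercolation (zdGraph d) p).real (E ∩ siteToBoundary d n) / oneArmProb d p n)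
        atTop (𝓝 (ν.real E)))
    {m : ℕ} {V : Finset (Site d)} (hVm : V ⊆ box d m) (h0 : (0 : Site d) ∈ V)
    {F G : Finset (Sym2 (Site d))} (hF : ∀ e, e ∈ F ↔ ∃ a ∈ V, ∃ b ∈ box d m, b ∉ V ∧ e = s(a, b))
    (hG : ∀ e ∈ G, ∀ v ∈ e, v ∈ V) (hVconn : ∀ v ∈ V, PathIn (openGraph (↑G : Set (Sym2 (Site d)))) (↑V : Set (Site d)) 0 v)
    {Ein : Set (BondConfig (Site d))} (hEin : DeterminedBy Ein (↑(F ∪ V.sym2) : Set (Sym2 (Site d))))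
    {Eout : Set (BondConfig (Site d))} {T : Finset (Sym2 (Site d))} (hEout : DeterminedBy Eout ↑T) (hT : Disjoint T (F ∪ V.sym2)) :
    ν.real (Ein ∩ ({ω : BondConfig (Site d) | ∀ e ∈ F, e ∉ ω} ∩ {ω | ∀ v ∈ V, ω ∈ openConnIn (↑V : Set (Site d)) 0 v}) ∩ Eout) *
        (bondPercolation (zdGraph d) p).real {ω : BondConfig (Site d) | (∀ e ∈ F, e ∉ ω) ∧ ∀ e ∈ G, e ∈ ω} =
      (bondPercolation (zdGraph d) p).real (Ein ∩ ({ω : BondConfig (Site d) | ∀ e ∈ F, e ∉ ω} ∩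
          {ω | ∀ v ∈ V, ω ∈ openConnIn (↑V : Set (Site d)) 0 v})) *
        ν.real (Eout ∩ {ω : BondConfig (Site d) | (∀ e ∈ F, e ∉ ω) ∧ ∀ e ∈ G, e ∈ ω}) := by
  classical
  set μ := bondPercolation (zdGraph d) p with hμ
  set CL := ({ω : BondConfig (Site d) | ∀ e ∈ F, e ∉ ω} ∩ {ω | ∀ v ∈ V, ω ∈ openConnIn (↑V : Set (Site d)) 0 v}) with hCLdef
  set C := {ω : BondConfig (Site d) | (∀ e ∈ F, e ∉ ω) ∧ ∀ e ∈ G, e ∈ ω} with hCdef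
  have hGsym : G ⊆ V.sym2 := fun e he => Finset.mem_sym2_iff.2 (hG e he)
  have hTK : Disjoint T (F ∪ G) := hT.mono_right (Finset.union_subset_union (subset_refl F) hGsym)
  have hEinm : MeasurableSet Ein := hEin.measurableSet_of_finset
  have hEoutm : MeasurableSet Eout := hEout.measurableSet_of_finset
  have hCLdet : DeterminedBy CL (↑(F ∪ V.sym2) : Set (Sym2 (Site d))) := by
    rw [Finset.coe_union]
    refine (determinedBy_forall_notMem F).mono Set.subset_union_left |>.inter ?_
    have h : {ω : BondConfig (Site d) | ∀ v ∈ V, ω ∈ openConnIn (↑V : Set (Site d)) 0 v} = ⋂ v ∈ V, openConnIn (↑V : Set (Site d)) 0 v := by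
      ext ω; simp only [Set.mem_setOf_eq, Set.mem_iInter]
    rw [h, determinedBy_iff]
    intro ω ω' hωω'
    simp only [Set.mem_iInter]
    refine forall₂_congr fun v _ => ?_
    have hdet := determinedBy_openConnIn (↑V : Set (Site d)) (0 : Site d) v (K := (↑F : Set (Sym2 (Site d))) ∪ ↑V.sym2)
      (by rw [Finset.coe_sym2]; exact Set.subset_union_right)
    exact (determinedBy_iff _ _).1 hdet ω ω' hωω'
  have hfull : DeterminedBy (Ein ∩ CL ∩ Eout) (↑((F ∪ V.sym2) ∪ T) : Set (Sym2 (Site d))) := by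
    rw [Finset.coe_union]
    exact ((hEin.inter hCLdet).mono Set.subset_union_left).inter (hEout.mono Set.subset_union_right)
  have hECdet : DeterminedBy (Eout ∩ C) (↑(T ∪ (F ∪ G)) : Set (Sym2 (Site d))) := by
    rw [Finset.coe_union]; exact (hEout.mono Set.subset_union_left).inter ((determinedBy_cyl F G).mono Set.subset_union_right)
  -- trivial case `P(C) = 0`
  by_cases hC : μ.real C = 0
  · have hνEC : ν.real (Eout ∩ C) = 0 := by
      have hlim := hν _ _ hECdet.measurableSet_of_finset hECdet
      refine tendsto_nhds_unique hlim (tendsto_const_nhds.congr' (Eventually.of_forall fun n => ?_))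
      have h0' : μ.real (Eout ∩ C ∩ siteToBoundary d n) = 0 :=
        le_antisymm ((measureReal_mono (fun ω hω => hω.1.2) (measure_ne_top μ _)).trans hC.le) measureReal_nonneg
      simp only [h0', zero_div]
    rw [hC, hνEC, mul_zero, mul_zero]
  -- `ν(E_in ∩ CL ∩ E_out) = P(E_in ∩ CL) · ν(E_out ∩ C)/P(C)`
  have hlimE : Tendsto (fun n : ℕ => μ.real (Eout ∩ {ω : BondConfig (Site d) | ∃ x ∈ V, ∃ t ∈ innerBoundary (zdGraph d) (box d n),
      ω \ (↑F : Set (Sym2 (Site d))) ∈ openConnIn (↑(box d n) : Set (Site d)) x t}) / oneArmProb d p n)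
      atTop (𝓝 (ν.real (Eout ∩ C) / μ.real C)) := by
    have hlim := hν _ _ hECdet.measurableSet_of_finset hECdet
    refine (hlim.div_const (μ.real C)).congr' ?_
    filter_upwards [eventually_ge_atTop m] with n hn
    rw [← real_inter_connOff_mul_real_cyl_eq p hG h0 hVconn (hVm.trans (box_mono d hn)) hEoutm hEout (Finset.disjoint_coe.2 hTK),
      div_right_comm, mul_div_assoc, div_self hC, mul_one]
  have hν3 : ν.real (Ein ∩ CL ∩ Eout) = μ.real (Ein ∩ CL) * (ν.real (Eout ∩ C) / μ.real C) := by
    have hlim := hν _ _ hfull.measurableSet_of_finset hfull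
    refine tendsto_nhds_unique hlim ((hlimE.const_mul (μ.real (Ein ∩ CL))).congr' ?_)
    filter_upwards [eventually_gt_atTop m] with n hn
    rw [← mul_div_assoc, real_insideClusterBox_inter_siteToBoundary_eq p hn hVm h0 hF hEinm hEin hEoutm hEout (Finset.disjoint_coe.2 hT)]
  rw [hν3]
  field_simp

/-- **THE INSIDE LAW: `ν(E_in ∩ CL_m(V)) · P_p(CL_m(V)) = P_p(E_in ∩ CL_m(V)) · ν(CL_m(V))`** — given the shape `V` of the cluster of the origin in
`Λ(m)`, the configuration on the pairs at `V` (which internal edges are open, etc.) has under Kesten's IIC EXACTLY its `P_p`-conditional law.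
(`E_in` any cylinder determined by `F ∪ V.sym2`; `V ∋ 0` connected through `G`, `V ⊆ Λ(m)`, `P_p(F closed, G open) > 0`; limit property only.)
[cite: Kesten1986, Thm. (3) and §2 (2.16)] [cite: BasuSapozhnikov2017ECP, Thm. 1.1] -/
theorem iicMeasure_real_inside_clusterBox_mul_eq (p : unitInterval) {ν : Measure (BondConfig (Site d))}
    (hν : ∀ (F : Finset (Sym2 (Site d))) (E : Set (BondConfig (Site d))), MeasurableSet E → DeterminedBy E ↑F →
      Tendsto (fun n : ℕ => (bondPercolation (zdGraph d) p).real (E ∩ siteToBoundary d n) / oneArmProb d p n)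
        atTop (𝓝 (ν.real E)))
    {m : ℕ} {V : Finset (Site d)} (hVm : V ⊆ box d m) (h0 : (0 : Site d) ∈ V)
    {F G : Finset (Sym2 (Site d))} (hF : ∀ e, e ∈ F ↔ ∃ a ∈ V, ∃ b ∈ box d m, b ∉ V ∧ e = s(a, b))
    (hG : ∀ e ∈ G, ∀ v ∈ e, v ∈ V) (hVconn : ∀ v ∈ V, PathIn (openGraph (↑G : Set (Sym2 (Site d)))) (↑V : Set (Site d)) 0 v)
    (hC : 0 < (bondPercolation (zdGraph d) p).real {ω : BondConfig (Site d) | (∀ e ∈ F, e ∉ ω) ∧ ∀ e ∈ G, e ∈ ω})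
    {Ein : Set (BondConfig (Site d))} (hEin : DeterminedBy Ein (↑(F ∪ V.sym2) : Set (Sym2 (Site d)))) :
    ν.real (Ein ∩ ({ω : BondConfig (Site d) | ∀ e ∈ F, e ∉ ω} ∩ {ω | ∀ v ∈ V, ω ∈ openConnIn (↑V : Set (Site d)) 0 v})) * (bondPercolation (zdGraph d) p).real ({ω : BondConfig (Site d) | ∀ e ∈ F, e ∉ ω} ∩ {ω | ∀ v ∈ V, ω ∈ openConnIn (↑V : Set (Site d)) 0 v}) =
      (bondPercolation (zdGraph d) p).real (Ein ∩ ({ω : BondConfig (Site d) | ∀ e ∈ F, e ∉ ω} ∩ {ω | ∀ v ∈ V, ω ∈ openConnIn (↑V : Set (Site d)) 0 v})) * ν.real ({ω : BondConfig (Site d) | ∀ e ∈ F, e ∉ ω} ∩ {ω | ∀ v ∈ V, ω ∈ openConnIn (↑V : Set (Site d)) 0 v}) := by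
  have h1 := iicMeasure_real_inside_outside_clusterBox_mul_eq p hν hVm h0 hF hG hVconn hEin (Eout := Set.univ) (T := ∅)
    ((determinedBy_iff _ _).2 fun ω ω' _ => by simp) (by simp)
  have h2 := iicMeasure_real_clusterBox_mul_eq p hν hVm h0 hF hG hVconn
  simp only [Set.inter_univ, Set.univ_inter] at h1
  have hC' := hC.ne'
  have e1 : ν.real (Ein ∩ ({ω : BondConfig (Site d) | ∀ e ∈ F, e ∉ ω} ∩ {ω | ∀ v ∈ V, ω ∈ openConnIn (↑V : Set (Site d)) 0 v})) =
      (bondPercolation (zdGraph d) p).real (Ein ∩ ({ω : BondConfig (Site d) | ∀ e ∈ F, e ∉ ω} ∩ {ω | ∀ v ∈ V, ω ∈ openConnIn (↑V : Set (Site d)) 0 v})) * ν.real {ω : BondConfig (Site d) | (∀ e ∈ F, e ∉ ω) ∧ ∀ e ∈ G, e ∈ ω} / (bondPercolation (zdGraph d) p).real {ω : BondConfig (Site d) | (∀ e ∈ F, e ∉ ω) ∧ ∀ e ∈ G, e ∈ ω} := by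
    rw [eq_div_iff hC']; exact h1
  have e2 : ν.real ({ω : BondConfig (Site d) | ∀ e ∈ F, e ∉ ω} ∩ {ω | ∀ v ∈ V, ω ∈ openConnIn (↑V : Set (Site d)) 0 v}) = (bondPercolation (zdGraph d) p).real ({ω : BondConfig (Site d) | ∀ e ∈ F, e ∉ ω} ∩ {ω | ∀ v ∈ V, ω ∈ openConnIn (↑V : Set (Site d)) 0 v}) * ν.real {ω : BondConfig (Site d) | (∀ e ∈ F, e ∉ ω) ∧ ∀ e ∈ G, e ∈ ω} / (bondPercolation (zdGraph d) p).real {ω : BondConfig (Site d) | (∀ e ∈ F, e ∉ ω) ∧ ∀ e ∈ G, e ∈ ω} := by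
    rw [eq_div_iff hC']; exact h2
  rw [e1, e2]
  field_simp

/-- **CONDITIONAL INDEPENDENCE OF INSIDE AND OUTSIDE GIVEN THE SHAPE: `ν(E_in ∩ CL ∩ E_out) · ν(CL) = ν(E_in ∩ CL) · ν(E_out ∩ CL)`**, `CL = CL_m(V)`,
for every inside cylinder `E_in` (determined by `F ∪ V.sym2`) and outside cylinder `E_out` (determined by finitely many pairs off `F ∪ V.sym2`);
`P_p(F closed, G open) > 0`; limit property only.  (All four quantities factor through `P_p(· ∩ CL)` and `ν(· ∩ C)/P_p(C)`.)
[cite: Kesten1986, Thm. (3) and §2 (2.16)] [cite: BasuSapozhnikov2017ECP, Thm. 1.1] -/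
theorem iicMeasure_condIndep_inside_outside_clusterBox (p : unitInterval) {ν : Measure (BondConfig (Site d))}
    (hν : ∀ (F : Finset (Sym2 (Site d))) (E : Set (BondConfig (Site d))), MeasurableSet E → DeterminedBy E ↑F →
      Tendsto (fun n : ℕ => (bondPercolation (zdGraph d) p).real (E ∩ siteToBoundary d n) / oneArmProb d p n)
        atTop (𝓝 (ν.real E)))
    {m : ℕ} {V : Finset (Site d)} (hVm : V ⊆ box d m) (h0 : (0 : Site d) ∈ V)
    {F G : Finset (Sym2 (Site d))} (hF : ∀ e, e ∈ F ↔ ∃ a ∈ V, ∃ b ∈ box d m, b ∉ V ∧ e = s(a, b))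
    (hG : ∀ e ∈ G, ∀ v ∈ e, v ∈ V) (hVconn : ∀ v ∈ V, PathIn (openGraph (↑G : Set (Sym2 (Site d)))) (↑V : Set (Site d)) 0 v)
    (hC : 0 < (bondPercolation (zdGraph d) p).real {ω : BondConfig (Site d) | (∀ e ∈ F, e ∉ ω) ∧ ∀ e ∈ G, e ∈ ω})
    {Ein : Set (BondConfig (Site d))} (hEin : DeterminedBy Ein (↑(F ∪ V.sym2) : Set (Sym2 (Site d))))
    {Eout : Set (BondConfig (Site d))} {T : Finset (Sym2 (Site d))} (hEout : DeterminedBy Eout ↑T) (hT : Disjoint T (F ∪ V.sym2)) :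
    ν.real (Ein ∩ ({ω : BondConfig (Site d) | ∀ e ∈ F, e ∉ ω} ∩ {ω | ∀ v ∈ V, ω ∈ openConnIn (↑V : Set (Site d)) 0 v}) ∩ Eout) * ν.real ({ω : BondConfig (Site d) | ∀ e ∈ F, e ∉ ω} ∩ {ω | ∀ v ∈ V, ω ∈ openConnIn (↑V : Set (Site d)) 0 v}) =
      ν.real (Ein ∩ ({ω : BondConfig (Site d) | ∀ e ∈ F, e ∉ ω} ∩ {ω | ∀ v ∈ V, ω ∈ openConnIn (↑V : Set (Site d)) 0 v})) * ν.real (Eout ∩ ({ω : BondConfig (Site d) | ∀ e ∈ F, e ∉ ω} ∩ {ω | ∀ v ∈ V, ω ∈ openConnIn (↑V : Set (Site d)) 0 v})) := by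
  have h3 := iicMeasure_real_inside_outside_clusterBox_mul_eq p hν hVm h0 hF hG hVconn hEin hEout hT
  have h1 := iicMeasure_real_inside_outside_clusterBox_mul_eq p hν hVm h0 hF hG hVconn hEin (Eout := Set.univ) (T := ∅)
    ((determinedBy_iff _ _).2 fun ω ω' _ => by simp) (by simp)
  have h2 := iicMeasure_real_clusterBox_mul_eq p hν hVm h0 hF hG hVconn
  have h4 := iicMeasure_real_inter_clusterBox_mul_eq p hν hVm h0 hF hG hVconn hEout hT
  simp only [Set.inter_univ, Set.univ_inter] at h1
  have hC' := hC.ne'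
  -- express everything through `ν(C)/P(C)` and `ν(Eout ∩ C)/P(C)`
  have e3 : ν.real (Ein ∩ ({ω : BondConfig (Site d) | ∀ e ∈ F, e ∉ ω} ∩ {ω | ∀ v ∈ V, ω ∈ openConnIn (↑V : Set (Site d)) 0 v}) ∩ Eout) =
      (bondPercolation (zdGraph d) p).real (Ein ∩ ({ω : BondConfig (Site d) | ∀ e ∈ F, e ∉ ω} ∩ {ω | ∀ v ∈ V, ω ∈ openConnIn (↑V : Set (Site d)) 0 v})) * ν.real (Eout ∩ {ω : BondConfig (Site d) | (∀ e ∈ F, e ∉ ω) ∧ ∀ e ∈ G, e ∈ ω}) / (bondPercolation (zdGraph d) p).real {ω : BondConfig (Site d) | (∀ e ∈ F, e ∉ ω) ∧ ∀ e ∈ G, e ∈ ω} := by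
    rw [eq_div_iff hC']; exact h3
  have e1 : ν.real (Ein ∩ ({ω : BondConfig (Site d) | ∀ e ∈ F, e ∉ ω} ∩ {ω | ∀ v ∈ V, ω ∈ openConnIn (↑V : Set (Site d)) 0 v})) =
      (bondPercolation (zdGraph d) p).real (Ein ∩ ({ω : BondConfig (Site d) | ∀ e ∈ F, e ∉ ω} ∩ {ω | ∀ v ∈ V, ω ∈ openConnIn (↑V : Set (Site d)) 0 v})) * ν.real {ω : BondConfig (Site d) | (∀ e ∈ F, e ∉ ω) ∧ ∀ e ∈ G, e ∈ ω} / (bondPercolation (zdGraph d) p).real {ω : BondConfig (Site d) | (∀ e ∈ F, e ∉ ω) ∧ ∀ e ∈ G, e ∈ ω} := by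
    rw [eq_div_iff hC']; exact h1
  have e2 : ν.real ({ω : BondConfig (Site d) | ∀ e ∈ F, e ∉ ω} ∩ {ω | ∀ v ∈ V, ω ∈ openConnIn (↑V : Set (Site d)) 0 v}) = (bondPercolation (zdGraph d) p).real ({ω : BondConfig (Site d) | ∀ e ∈ F, e ∉ ω} ∩ {ω | ∀ v ∈ V, ω ∈ openConnIn (↑V : Set (Site d)) 0 v}) * ν.real {ω : BondConfig (Site d) | (∀ e ∈ F, e ∉ ω) ∧ ∀ e ∈ G, e ∈ ω} / (bondPercolation (zdGraph d) p).real {ω : BondConfig (Site d) | (∀ e ∈ F, e ∉ ω) ∧ ∀ e ∈ G, e ∈ ω} := by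
    rw [eq_div_iff hC']; exact h2
  -- `ν(CL ∩ Eout)·ν(C) = ν(CL)·ν(Eout ∩ C)` (Markov property, h4 with `E = Eout`): rewrite `ν(CL ∩ Eout)`
  by_cases hνC : ν.real {ω : BondConfig (Site d) | (∀ e ∈ F, e ∉ ω) ∧ ∀ e ∈ G, e ∈ ω} = 0
  · -- then `ν(CL) = 0` and `ν(Ein ∩ CL) = 0` by e1/e2, both sides vanish
    rw [e1, e2, hνC]; simp
  have e4 : ν.real (Eout ∩ ({ω : BondConfig (Site d) | ∀ e ∈ F, e ∉ ω} ∩ {ω | ∀ v ∈ V, ω ∈ openConnIn (↑V : Set (Site d)) 0 v})) = ν.real ({ω : BondConfig (Site d) | ∀ e ∈ F, e ∉ ω} ∩ {ω | ∀ v ∈ V, ω ∈ openConnIn (↑V : Set (Site d)) 0 v}) * ν.real (Eout ∩ {ω : BondConfig (Site d) | (∀ e ∈ F, e ∉ ω) ∧ ∀ e ∈ G, e ∈ ω}) / ν.real {ω : BondConfig (Site d) | (∀ e ∈ F, e ∉ ω) ∧ ∀ e ∈ G, e ∈ ω} := by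
    rw [eq_div_iff hνC]; exact h4
  rw [e3, e1, e4, e2]
  field_simp

end Summit.CriticalPhenomena.PercolationContinuityZ3.Theorems.Crossing
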